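import Summits.BirchSwinnertonDyer.Rank1Residual.X11a.SelmerCompanionRoute
import Summits.BirchSwinnertonDyer.Rank1Residual.X11a.SelmerCompanionSixKinds
import Summits.BirchSwinnertonDyer.Rank1Residual.Additive.X4RankZeroVisibleLowerHalfSockets
import Summits.BirchSwinnertonDyer.Rank1Residual.Additive.X4RankZeroKatoBound
import Literature.NumberTheory.EllipticCurves.OpenImageMazurAssemblyProofs
import Literature.NumberTheory.EllipticCurves.MordellWeilRankZeroProofs
import HarnessLib

/-!
# O6 (wild additive `p = 3`), GEN 23 — T-X4-ШT: **Ш-TRANSPORT along a mod-`p` congruence**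
# (the Selmer-companion count read in the LOWER direction; cell `b2b-bsdres`, unit `b2b-bsdres-o6-r1`)

(TYPER'S RECORD — cc-typer-5 GEN 16; docket cc-lead ⟦gen61⟧ (2′)(iv′) (c26), ROUTED BY NAME by o6-r1 GEN 23 (HOME/INBOX.md
 2026-08-22T13:21Z l.12009; superseded-in-place notice 13:43Z l.12099).  Source = the FROZEN theorems-only file
 `HOME/b2b-bsdres-o6-r1/gen23/lean/O6X4ShaTransport.lean` (sha256 `e561bc76d775eb33…`, 636 l. / 14 decls; `SHA256SUMS.gen23` stanza 2
 FINAL; `lean check` rc 0 / 0 sorries / 0 warnings by the planner and re-checked by lit-kato), placed as TWO tree files for `lint.size`: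
 THIS file = the planner's module text (verbatim below) + §1 (the number-field count) + §2 (the partner side over `ℚ`);
 `O6/X4ShaTransportEnd.lean` = §3 (the LOWER-half socket and the END over `ℚ`) + §4 (the SIX-KINDS form).  Decl blocks byte-identical
 to the frozen source; `@[conjecture]` × 0; 0 definitions; 0 Literature facts — every published input is a DISPLAYED binder in the
 tree's vocabulary (A161 `hKato`, bsd.S18 `hCT`, bsd.S17 `hGZK`, `hmod`, A41 `hU` / `hU2`, `hEP`).
 AUDIT WORDS OF RECORD: **lit-kato AUD-21 (a)–(c) PASS ×3 (GEN 42, `HOME/b2b-bsdres-lit-kato/gen42/AUD-21-gen42.md` 91c2db7cdb4d3975)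
 and AUD-21 (d) PASS, 0 flags (GEN 43, `gen43/AUD-21d-gen43.md` 357e29660c2ddca9): typed END FAITHFUL (partner in the bounded slot;
 budget exactly `p` from `v = p`; CT square from AEC X.4.14's main clause; role exchange and kind (iii) at `v = 2` correct)**; NIT N-9
 (doc-only, optional; NOT applied to the planner's docstrings): `[cite: MazurRubin2004, §2.3]` is PROVENANCE for a count PROVED in the
 tree (`X11a/SelmerCompanionBound.lean`); a held locator for its duality-sharp form is Mazur–Rubin, Invent. Math. 181 (2010) Lemma 3.2
 [MazurRubin2010]; N-10 optional (Kato Prop. 14.16 (2) p. 244 rides A161's own cite).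
 CENSUS WORDS OF RECORD (EVIDENCE; census-lead GEN 27 l.12101): C-ШT-0 run of record j163346 — 'ZERO CERTIFIED VIOLATIONS on 54 858
 pairs — AS PREDICTED' STANDS; side-prediction anomaly CLOSED (precision-30 instrument artefact); C-ШT-1 j163520 PREREG-BEFORE-ID MET,
 P-ШT-6k 0 certified violations on 226 835 pairs AS PREDICTED; numbers (o6-r1 l.12099): 472 890 trace-verified pairs, certificates
 2 330 / 2 330, CORE 1 277 (746 with a partner), crude END 56 CORE targets with an S-b-CLOSED partner + 70 R3 edges, six-kinds END
 249 / 1 277 (P 365 / L 2 / R 5 pairs) + 203 R3 DEPENDENCY EDGES; census LABEL: 'the 249 = CANDIDATES via T-X4-ШT-6k; outputs = EVIDENCE,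
 R3 = dependency edge; nothing moves until the file is accepted AND per-target facts are typed'.  Nothing booked; O6 OPEN.
 DEDUP (`lean search`, 2026-08-22): the 14 names are new in namespace `…Rank1Residual.O6`; `addEquiv_symm_smul_of_equivariant'` is the
 planner's `ℚ`-specialised twin of the tree's `Additive.addEquiv_symm_smul_of_equivariant` (general field,
 `Additive/CompanionTypeIffLocIrrThreeHolds.lean`), kept verbatim (3-line proof) so that the frozen proof terms stay untouched; reused by
 import: `X11a.SelmerCompanion.natCard_selmerGroup_le_of_congr_of_le_off` / `…_of_six_kinds_rat` / `…_eq_one_of_le`,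
 `Additive.RankZero.missingLowerBoundAt_of_exists_sha_torsion`, `Additive.X4RankZero.bsdp_of_missingLowerBoundAt_of_kato`,
 `finite_point_of_analyticRank_eq_zero`, `coprime_natCard_point_of_irr`, `Mazur1978.hasIrreducibleModPGaloisRep_of_addEquiv`.
 PRESEARCH (typer, corpus + galaxy): "Selmer companion congruence lower bound Sha" → [corpus: paper:arxiv-1203.0620 (Mazur–Rubin 2015)
 Thm. 3.1; paper:anon2010-ranks-twists… (Mazur–Rubin 2010) Lemma 3.2] = the cited antecedents; galaxy `--star all` 0 rows —
 `presearch: T-X4-ШT → none beyond the cited antecedents`.)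

HONEST FRAMING (run/shared/lean/b2b/bsd-rank1-residual/, verbatim in every file): the goal of the
cell is to DELETE the COMBINATION-SHAPED residual classes of the Birch–Swinnerton-Dyer formula for
ALL analytic-rank `≤ 1` elliptic curves over `ℚ` — "full BSD formula for every rank `≤ 1` curve in
class `C`" assembled STRICTLY from published theorems — so that the rank-`≤ 1` remainder becomes
exactly the CONSTRUCTION-SHAPED classes, which are TYPED (missing-input `Prop`s), NOT attempted.
This is not "finishing BSD". CLASS-OWNERS.md: research routes; NO CLAIM BEYOND STATED CLASSES.
THEOREMS ONLY (no definition, no named fact, no `sorry`); EVIDENCE seat — nothing is booked by this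
file, no label moves, no RESIDUAL-MAP mark moves. Every theorem is CONDITIONAL on the named PUBLISHED
facts in its binders (Cassels–Tate `hCT`, Gross–Zagier–Kolyvagin `hGZK`, modularity `hmod`, Kato 2004
Thm. 14.5 (3) `hKato`) and on the per-pair finite inputs it names.

## What this file proves (o6-r1 GEN 23, seat O6 PLANNER 1 — "Iwasawa side")

The wild potentially-good X4 rank-`0` CORE of O6 at `p = 3` (`9 ∣ #Ш_an(E)`, `ρ̄_{E,3^∞}` onto,
`3 ∤ ∏ c_ℓ`, `3 ∤ c_D`) is reduced by Kato's divisibility to its LOWER half `MissingLowerBoundAt E 3`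
(`X4RankZero.bsdp_of_missingLowerBoundAt_of_kato`). The tree's LOWER-half producers along a
`3`-congruence `θ : A[3] ≃ E[3]` are all driven by RATIONAL POINTS of the partner `A`
(`exists_sha_ne_zero_of_congr_of_index_lt` and its `…_of_rank`, `…_of_places`, `…_of_locallyDivisible`
forms: `[A(ℚ):3A(ℚ)]` must beat the local budget, i.e. `rank A ≥ 2`, or `rank A = 1` with a locally
divisible generator). This file adds the producer driven by the partner's **Ш**: the X11a
Selmer-companion count `#Sel^(p)(A) ≤ #Sel^(p)(E) · ∏_{v∈T} #𝓛_v(A)`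
(`X11a.SelmerCompanion.natCard_selmerGroup_le_of_congr_of_le_off`, Mazur–Rubin, *Kolyvagin systems*
§2.3, there used in the UPPER direction `BSD(A,p) ⟹ Sel^(p)(E) = 0`) read in the LOWER direction:

* `exists_sha_ne_zero_of_congr_of_lt_natCard_selmerGroup` (any number field `K`, any odd `p`): if
  `#E(K)` is finite and prime to `p` and `∏_{v∈T} #𝓛_v(A) < #Sel^(p)(A/K)` (local conditions agreeing
  along `θ` off `T`), then `Ш(E/K)[p] ≠ 0`;
* `lt_natCard_selmerGroup_of_exists_sha_ne_zero` (over `ℚ`): a rank-`0` partner with `A(ℚ)[p] = 0`,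
  `Ш(A)[p^∞]` finite and `Ш(A)[p] ≠ 0` has `#Sel^(p)(A/ℚ) > p` (Cassels–Tate: `#Ш(A)[p]` is a square);
* `exists_sha_ne_zero_of_bsdp_of_padicValRat_pos`: `BSD(A,p)` and `ord_p #Ш_an(A) > 0` give
  `Ш(A)[p] ≠ 0` (Cauchy in the finite `p`-primary part);
* **`RankZero.missingLowerBoundAt_of_congr_of_shaPartner`** — the LOWER-half socket: `E` of analytic
  rank `0`, `E[p]` irreducible, `ord_p #Ш_an(E) ≤ 2`, a `p`-congruent partner `A` with `BSD(A,p)`,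
  `r_an(A) = 0`, `ord_p #Ш_an(A) > 0`, and `A(ℚ_v)[p] = 0` at every place of `S ⊇ {bad places, p}`
  ⟹ `MissingLowerBoundAt E p` — NO condition on the reduction of `E` or `A` at `p` (so it serves the
  WILD additive rows of O6, where no ordinary/signed Iwasawa theory exists: a curve wildly ramified at
  `3` is potentially supersingular there), NO Tate-curve binder, NO point search;
* **`X4RankZero.bsdp_of_congr_of_shaPartner_of_kato`** — the END `BSD(E,p)` on X4 ∧ `r_an = 0` ∧
  potentially good at `p`, from Kato's UPPER half and the Ш-partner (the exact twin of
  `X4RankZero.bsdp_of_congr_of_rank_two_of_kato`, the rank-two binder `2 ≤ rank A` replaced by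
  `BSD(A,p) ∧ r_an(A) = 0 ∧ 0 < ord_p #Ш_an(A)`);
* `RankZero.missingLowerBoundAt_of_congr_of_shaPartner_of_le_off` — the refined form with a lossy
  subset `T ⊆ S` of budget `∏_{v∈T} #𝓛_v(A) ≤ p` and agreement of the local conditions along `θ` on
  `S \ T` (discharged per row by the tree's kind lemmas: `A(ℚ_v)[p] = 0`; split / twisted Tate;
  good-vs-non-split level raising), for partners with a place `v ≠ p` where `3 ∣ c_v`.

WHY THIS IS THE SEAT'S "IWASAWA SIDE" (memo O6-GEN23.md §2): for a curve WILDLY ramified at `3`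
(`v₃(N) ≥ 3`, semistability defect `e ∈ {3, 4, 6, 12}` with `3 ∣ e` in the wild cases) the reduction
over the semistabilising field is SUPERSINGULAR (`Aut(Ẽ/𝔽̄₃) ⊇ ℤ/3 ⇒ j̃ = 0`), so there is NO
nearly-ordinary deformation, no Greenberg–Vatsal / Emerton–Pollack–Weston `λ`/`μ`-transport and no
signed (Kobayashi/Sprung/Lei–Loeffler–Zerbes) theory over `ℚ` at an additive prime in print; what a
"`3`-adic `L`-function after potentially-good base change" would have to deliver for BSD₃ of a rank-`0`
wild curve is EXACTLY the lower bound `ord₃ #Ш(E) ≥ ord₃ #Ш_an(E)`, and the only published engines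
that move `3`-parts of Ш between curves without an ordinary hypothesis are (a) Kato's Euler system
(upper half, in the tree) and (b) the finite-level comparison of Selmer structures along `E[3] ≅ A[3]`
(this file). The partner `A` is chosen where an Iwasawa main conjecture IS a theorem (good ordinary
or multiplicative at `3`: Skinner–Urban + Kato; or `N_A < 5000`: Miller–Stoll), so the main
conjecture is imported along the congruence at finite level instead of being descended from a base
change: LEVEL-change-and-transport replaces BASE-change-and-descend.

CENSUS (EVIDENCE, not booked): instrument C-ШT-0 (memo §3; kit job registered in HOME/INBOX.md):
for each O6 core target, Cremona partners `A` with `A[3] ≅ E[3]` (trace sieve + octic `3`-division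
field isomorphism + symplectic check), `r_an(A) = 0`, `3 ∣ #Ш_an(A)`, `BSD(A,3)` decidable in print,
and `A(ℚ_v)[3] = 0` on `S`. PREDICTION P-ШT (falsifiable): along every such pair
`3 ∣ #Ш_an(E) ⟺ 3 ∣ #Ш_an(A)` (the two Selmer groups differ by at most one factor `3` and both
`#Ш[3]` are squares).
§4 (SIX KINDS, census C-ШT-1 / prediction P-ШT-6k): the agreement off the lossy set `T` is
discharged by the tree's six kinds of places (X11a file XII
`natCard_selmerGroup_le_of_congr_of_six_kinds_rat`, roles exchanged: the partner is the bounded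
curve) — `RankZero.missingLowerBoundAt_of_congr_of_shaPartner_six_kinds`,
`X4RankZero.bsdp_of_congr_of_shaPartner_of_kato_six_kinds`; with `T = {p}` the only local
requirement left at `p` is `A(ℚ_p)[p] = 0`.

## References

* [MazurRubin2004] B. Mazur, K. Rubin, *Kolyvagin systems*, Mem. AMS 799 (2004), §2.3 (comparison
  of Selmer structures; the count behind `natCard_selmerGroup_le_of_congr`).
* [CremonaMazur2000] J. E. Cremona, B. Mazur, *Visualizing elements in the Shafarevich–Tate group*,
  Experiment. Math. 9 (2000), §3 (visibility: the point-driven lower direction).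
* B. Mazur, K. Rubin, *Selmer companion curves*, Trans. AMS 367 (2015), Thm. 3.1 / §7.3
  (arXiv:1203.0620): when ALL local conditions agree the `p`-Selmer groups are isomorphic.
* [Kato2004Asterisque] K. Kato, Astérisque 295 (2004), Thm. 14.5 (3) (the upper half `hKato`).
* [SkinnerUrban2014] C. Skinner, E. Urban, Invent. Math. 195 (2014), Thm. 3.29 / 3.33 (BSD_p of the
  rank-`0` partner when `A` is good ordinary / multiplicative at `p`); [Miller2011LMS] Def. 1.1,
  Thm. 1.2 (`N_A < 5000`).
* [SilvermanAEC2009] Thm. X.4.2, X.4.14; [Dokchitser2013ParityNotes] §2 (`#Ш[p]` a square, `hCT`).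
* HOME/b2b-bsdres-o6-r1/gen23/O6-GEN23.md (this gen's memo); HOME/b2b-bsdres-x11a/REPORT-g26.md
  (route (3e), the upper direction); cells/n1011/ROUTE-1.md (T-VIS3, the point-driven lower direction).
-/

set_option autoImplicit false

noncomputable section

open scoped Classical

open WeierstrassCurve Literature.NumberTheory.EllipticCurves
  Literature.NumberTheory.EllipticCurves.ModularForms
  Literature.NumberTheory.EllipticCurves.Rank1Residual
  Literature.NumberTheory.EllipticCurves.Rank1Residual.Typed
  Literature.NumberTheory.GaloisRepresentations Field NumberField IsDedekindDomain

namespace Summit.BirchSwinnertonDyer.Rank1Residual.O6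

/-! ### §1. The LOWER-direction Selmer-companion count over a number field -/

section NumberFieldCount

variable {K : Type} [Field K] [NumberField K] (W W' : WeierstrassCurve K) [W.IsElliptic]
  [W'.IsElliptic] {p : ℕ} [Fact p.Prime]

omit [NumberField K] [W.IsElliptic] [W'.IsElliptic] [Fact p.Prime] in
/-- In a finite abelian group of order prime to `p` the `p`-torsion subgroup is trivial:
`#A[p] = 1`. [folklore] -/
theorem natCard_torsionBy_eq_one_of_coprime {A : Type*} [AddCommGroup A] [Finite A]
    (hA : (Nat.card A).Coprime p) : Nat.card (AddSubgroup.torsionBy A (p : ℤ)) = 1 := by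
  rw [AddSubgroup.card_eq_one, eq_bot_iff]
  intro a ha
  rw [AddSubgroup.mem_bot]
  have hpa : p • a = 0 := AddSubgroup.torsionBy.nsmul_iff.mp ha
  have h1 : addOrderOf a ∣ p := addOrderOf_dvd_of_nsmul_eq_zero hpa
  have h2 : addOrderOf a ∣ Nat.card A := addOrderOf_dvd_natCard a
  have h3 : addOrderOf a ∣ Nat.gcd (Nat.card A) p := Nat.dvd_gcd h2 h1
  rw [hA, Nat.dvd_one] at h3
  exact AddMonoid.addOrderOf_eq_one_iff.mp h3

/-- **Ш-transport, LOWER direction (the Selmer-companion count read downwards).** Let `E = W`,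
`A = W'` be elliptic curves over a number field `K`, `p` odd, `θ : A[p] ≃ E[p]` a `Γ_K`-equivariant
isomorphism, `S ⊇ T` finite sets of finite places with both curves good and `v ∤ p` outside `S`, and
suppose the local Kummer conditions agree along `θ` at the places of `S \ T`
(`θ_* 𝓢_v(A) ≤ 𝓢_v(E)`). If `E(K)` is finite of order prime to `p` and
**`∏_{v ∈ T} #𝓛_v(A) < #Sel^(p)(A/K)`** (`#𝓛_v(A) = #A(K_v)[p] · #(𝓞_v/p)`), then `Ш(E/K)` has a
non-zero element killed by `p`. Proof: `#Sel^(p)(A) ≤ #Sel^(p)(E) · ∏_{v∈T} #𝓛_v(A)`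
(`X11a.SelmerCompanion.natCard_selmerGroup_le_of_congr_of_le_off`) forces `#Sel^(p)(E) > 1`, and
`#Sel^(p)(E) = p^{rank E(K)} · #E(K)[p] · #Ш(E)[p] = #Ш(E)[p]` (`natCard_selmerGroup_eq`, AEC X.4.2).
The twin of the tree's point-driven `exists_sha_ne_zero_of_congr_of_index_lt`, with the partner's
SELMER group in place of `A(K)/pA(K)` — so a partner of rank `0` with `Ш(A)[p] ≠ 0` is admissible.
[cite: MazurRubin2004, §2.3] [cite: SilvermanAEC2009, Thm X.4.2] -/
theorem exists_sha_ne_zero_of_congr_of_lt_natCard_selmerGroup (hp2 : p ≠ 2)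
    (θ : geomTorsion W' (p : ℤ) ≃+ geomTorsion W (p : ℤ))
    (hθ : ∀ (σ : absoluteGaloisGroup K) (P : geomTorsion W' (p : ℤ)), θ (σ • P) = σ • θ P)
    (S T : Finset (HeightOneSpectrum (𝓞 K))) (hTS : T ⊆ S)
    (hS : ∀ v : HeightOneSpectrum (𝓞 K), v ∉ S →
      W.HasGoodReductionAt v ∧ W'.HasGoodReductionAt v ∧ (p : 𝓞 K) ∉ v.asIdeal)
    (hagree : ∀ v ∈ S, v ∉ T → ∀ c ∈ selmerLocalKer W' (v.adicCompletion K) (p : ℤ),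
      h1Equiv θ hθ c ∈ selmerLocalKer W (v.adicCompletion K) (p : ℤ))
    [Finite W.toAffine.Point] (hcop : (Nat.card W.toAffine.Point).Coprime p)
    (hlt : ∏ v ∈ T, Nat.card (W'.kummerLocalConditionAt (p : ℤ) (v.adicCompletion K)) <
      Nat.card (W'.selmerGroup (p : ℤ))) :
    ∃ c : W.sha, c ≠ 0 ∧ p • c = 0 := by
  have hp : p.Prime := Fact.out
  have hle := X11a.SelmerCompanion.natCard_selmerGroup_le_of_congr_of_le_off W W' hp2 θ hθ S T hTS
    hS hagree
  -- `#Sel^(p)(E) > 1`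
  have hone : 1 < Nat.card (W.selmerGroup (p : ℤ)) := by
    by_contra h
    push Not at h
    have h' := hle.trans (Nat.mul_le_mul_right _ h)
    rw [one_mul] at h'
    exact absurd (hlt.trans_le h') (lt_irrefl _)
  -- `#Sel^(p)(E) = #Ш(E)[p]`
  have hSel := W.natCard_selmerGroup_eq hp.ne_zero
  rw [W.mordellWeilRank_eq_zero_of_finite, pow_zero, one_mul, natCard_torsionBy_eq_one_of_coprime hcop,
    one_mul] at hSel
  rw [hSel] at hone
  haveI : Finite (W.sha ⊓ AddSubgroup.torsionBy W.galH1 (p : ℤ) : AddSubgroup W.galH1) :=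
    Nat.finite_of_card_ne_zero (by omega)
  obtain ⟨x, hx⟩ := AddSubgroup.ne_bot_iff_exists_ne_zero.mp
    ((AddSubgroup.one_lt_card_iff_ne_bot _).mp hone)
  refine ⟨⟨(x : W.galH1), (AddSubgroup.mem_inf.mp x.2).1⟩, fun h0 ↦ hx ?_, ?_⟩
  · have h1 : (x : W.galH1) = 0 := congrArg Subtype.val h0
    exact Subtype.ext (h1.trans (ZeroMemClass.coe_zero _).symm)
  · have hpx : p • (x : W.galH1) = 0 :=
      AddSubgroup.torsionBy.nsmul_iff.mp (AddSubgroup.mem_inf.mp x.2).2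
    apply Subtype.ext
    rw [AddSubgroupClass.coe_nsmul, ZeroMemClass.coe_zero]
    exact hpx

/-- **The crude form (`T = S`): no agreement hypothesis.** If `A(K_v)[p] = 0` at every place of `S`
then `∏_{v∈S} #𝓛_v(A) = p^{[K:ℚ]}` (`natCard_kummerLocalConditionAt_adicCompletion`,
`prod_natCard_quot_adicCompletionIntegers`), so **`p^{[K:ℚ]} < #Sel^(p)(A/K)`** suffices — the twin of
`exists_sha_ne_zero_of_congr_of_rank` (there: `p^{[K:ℚ]+1} ≤ p^{rank A} ≤ [A(K):pA(K)]`).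
[cite: MazurRubin2004, §2.3] [cite: CremonaMazur2000, §3] [cite: MilneADT2006, I Lemma 3.3] -/
theorem exists_sha_ne_zero_of_congr_of_pow_lt_natCard_selmerGroup (hp2 : p ≠ 2)
    (θ : geomTorsion W' (p : ℤ) ≃+ geomTorsion W (p : ℤ))
    (hθ : ∀ (σ : absoluteGaloisGroup K) (P : geomTorsion W' (p : ℤ)), θ (σ • P) = σ • θ P)
    (S : Finset (HeightOneSpectrum (𝓞 K)))
    (hS : ∀ v : HeightOneSpectrum (𝓞 K), v ∉ S →
      W.HasGoodReductionAt v ∧ W'.HasGoodReductionAt v ∧ (p : 𝓞 K) ∉ v.asIdeal)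
    [Finite W.toAffine.Point] (hcop : (Nat.card W.toAffine.Point).Coprime p)
    (hloc : ∀ v ∈ S, Nat.card (nsmulAddMonoidHom p :
      (W'.baseChange (v.adicCompletion K)).toAffine.Point →+ _).ker = 1)
    (hlt : p ^ Module.finrank ℚ K < Nat.card (W'.selmerGroup (p : ℤ))) :
    ∃ c : W.sha, c ≠ 0 ∧ p • c = 0 := by
  have hp : p.Prime := Fact.out
  refine exists_sha_ne_zero_of_congr_of_lt_natCard_selmerGroup W W' hp2 θ hθ S S le_rfl hS
    (fun v hv hv' ↦ absurd hv hv') hcop ?_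
  have hprod : ∏ v ∈ S, Nat.card (W'.kummerLocalConditionAt (p : ℤ) (v.adicCompletion K)) =
      (∏ v ∈ S, Nat.card (nsmulAddMonoidHom p :
          (W'.baseChange (v.adicCompletion K)).toAffine.Point →+ _).ker) * p ^ Module.finrank ℚ K := by
    rw [← prod_natCard_quot_adicCompletionIntegers (p := p) S fun v hv ↦ (hS v hv).2.2,
      ← Finset.prod_mul_distrib]
    exact Finset.prod_congr rfl fun v _ ↦ W'.natCard_kummerLocalConditionAt_adicCompletion v hp.ne_zero
  rw [hprod, Finset.prod_eq_one hloc, one_mul]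
  exact hlt

/-- **A rank-`0` curve with `A(K)[p] = 0`, `Ш(A)[p^∞]` finite and `Ш(A)[p] ≠ 0` has
`#Sel^(p)(A/K) > p`** (any number field `K`). By the Cassels–Tate pairing (`hCT`) `#Sel^(p)(A) = #Ш(A)[p] = p^{2m}`
(`X11a.SelmerCompanion.natCard_selmerGroup_eq_one_of_le`: `#Sel^(p) ≤ p` would force `Sel^(p) = 0`),
and `Sel^(p)(A) ⊇` the image of the non-zero class. [cite: Dokchitser2013ParityNotes, §2]
[cite: SilvermanAEC2009, Thm X.4.2] -/
theorem lt_natCard_selmerGroup_of_exists_sha_ne_zero (hCT : exists_casselsTate_pairing (K := K))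
    (A : WeierstrassCurve K) [A.IsElliptic]
    (hrank : A.mordellWeilRank = 0) (hfin : Finite (AddCommGroup.primaryComponent A.sha p))
    (ht : Nat.card (AddSubgroup.torsionBy A.toAffine.Point (p : ℤ)) = 1)
    (hSha : ∃ c : A.sha, c ≠ 0 ∧ p • c = 0) : p < Nat.card (A.selmerGroup (p : ℤ)) := by
  have hpP : p.Prime := Fact.out
  by_contra hle
  push Not at hle
  have h1 := X11a.SelmerCompanion.natCard_selmerGroup_eq_one_of_le hCT A p hrank hfin ht hle
  -- `#Ш(A)[p] = 1`
  have hSel := A.natCard_selmerGroup_eq hpP.ne_zero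
  rw [h1, hrank, pow_zero, one_mul, ht, one_mul] at hSel
  have hbot : (A.sha ⊓ AddSubgroup.torsionBy A.galH1 (p : ℤ) : AddSubgroup A.galH1) = ⊥ :=
    AddSubgroup.card_eq_one.mp hSel.symm
  obtain ⟨c, hc0, hpc⟩ := hSha
  have hmem : (c : A.galH1) ∈ (A.sha ⊓ AddSubgroup.torsionBy A.galH1 (p : ℤ) : AddSubgroup A.galH1) := by
    refine AddSubgroup.mem_inf.mpr ⟨c.2, AddSubgroup.torsionBy.nsmul_iff.mpr ?_⟩
    rw [← AddSubgroupClass.coe_nsmul, hpc, ZeroMemClass.coe_zero]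
  rw [hbot, AddSubgroup.mem_bot] at hmem
  exact hc0 (Subtype.ext hmem)

end NumberFieldCount

/-! ### §2. The partner side over `ℚ`: `Ш(A)[p] ≠ 0 ⟹ #Sel^(p)(A) > p` (Cassels–Tate square) -/

section Partner

variable (A : WeierstrassCurve ℚ) [A.IsElliptic] (p : ℕ) [hp : Fact p.Prime]

omit [A.IsElliptic] in
/-- **`BSD(A,p)` with `ord_p #Ш_an(A) > 0` gives a non-zero element of `Ш(A)[p]`.** Miller's
`BSD(A,p)`: `Ш(A)[p^∞]` is finite and `ord_p #Ш(A)[p^∞] = ord_p #Ш_an(A) > 0` (the rational `#Ш_an`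
is unique), so `p ∣ #Ш(A)[p^∞]` and Cauchy's theorem gives an element of order `p`.
[cite: Miller2011LMS, Def. 1.1 (arXiv:1010.2431 p. 3)] -/
theorem exists_sha_ne_zero_of_bsdp_of_padicValRat_pos (hbsd : BSDp A p) {q : ℚ}
    (hq : shaAn A = (q : ℂ)) (hv : 0 < padicValRat p q) : ∃ c : A.sha, c ≠ 0 ∧ p • c = 0 := by
  have hpP : p.Prime := hp.out
  obtain ⟨-, hfin, q', hq', hv'⟩ := hbsd
  have hqq : q' = q := by
    have h : ((q' : ℝ) : ℂ) = ((q : ℝ) : ℂ) := by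
      rw [Complex.ofReal_ratCast, Complex.ofReal_ratCast, ← hq, ← hq']
    exact_mod_cast h
  subst hqq
  haveI := hfin
  set T : AddSubgroup A.sha := AddCommGroup.primaryComponent A.sha p with hT
  have hpos : 0 < padicValNat p (Nat.card T) := by
    have h : (0 : ℤ) < (padicValNat p (Nat.card T) : ℤ) := by
      have := hv; rw [hv'] at this; exact_mod_cast this
    exact_mod_cast h
  have hdvd : p ∣ Nat.card T := by
    by_contra hnd
    rw [padicValNat.eq_zero_of_not_dvd hnd] at hpos
    exact lt_irrefl 0 hpos
  obtain ⟨x, hx⟩ := exists_prime_addOrderOf_dvd_card' (G := T) p hdvd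
  refine ⟨(x : A.sha), fun h0 ↦ ?_, ?_⟩
  · have h1 : addOrderOf x = 1 := by
      rw [AddMonoid.addOrderOf_eq_one_iff]
      exact Subtype.ext (by rw [h0]; rfl)
    rw [hx] at h1
    exact hpP.one_lt.ne' h1
  · have h2 : p • x = 0 := by rw [← hx]; exact addOrderOf_nsmul_eq_zero x
    have h3 := congrArg Subtype.val h2
    rw [AddSubgroupClass.coe_nsmul, ZeroMemClass.coe_zero] at h3
    exact h3

omit [A.IsElliptic] hp in
/-- The inverse of a `Γ`-equivariant additive isomorphism is `Γ`-equivariant. [folklore] -/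
theorem addEquiv_symm_smul_of_equivariant' {W : WeierstrassCurve ℚ}
    (θ : geomTorsion A (p : ℤ) ≃+ geomTorsion W (p : ℤ))
    (hθ : ∀ (σ : absoluteGaloisGroup ℚ) (P : geomTorsion A (p : ℤ)), θ (σ • P) = σ • θ P)
    (σ : absoluteGaloisGroup ℚ) (Q : geomTorsion W (p : ℤ)) : θ.symm (σ • Q) = σ • θ.symm Q := by
  apply θ.injective
  rw [AddEquiv.apply_symm_apply, hθ, AddEquiv.apply_symm_apply]

/-- **The partner's Selmer budget from `BSD(A,p)`.** For a partner `A` with `A[p]` irreducible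
(transported from `E[p]` along `θ`), `BSD(A,p)`, `r_an(A) = 0` and `ord_p #Ш_an(A) > 0`:
`p < #Sel^(p)(A/ℚ)`. [cite: Miller2011LMS, Def. 1.1 (arXiv:1010.2431 p. 3)]
[cite: Dokchitser2013ParityNotes, §2] [cite: Mazur1977, Ch. III §5, p. 157] -/
theorem lt_natCard_selmerGroup_of_bsdp_of_padicValRat_pos (hCT : exists_casselsTate_pairing (K := ℚ))
    (hirr : A.HasIrreducibleModPGaloisRep p) (hbsd : BSDp A p) (hr : A.analyticRank = 0) {q : ℚ}
    (hq : shaAn A = (q : ℂ)) (hv : 0 < padicValRat p q) : p < Nat.card (A.selmerGroup (p : ℤ)) := by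
  have hrank : A.mordellWeilRank = 0 := hbsd.1.trans hr
  exact lt_natCard_selmerGroup_of_exists_sha_ne_zero hCT A hrank hbsd.2.1
    (by convert natCard_torsionBy_eq_one_of_hasIrreducibleModPGaloisRep A p hirr)
    (exists_sha_ne_zero_of_bsdp_of_padicValRat_pos A p hbsd hq hv)

end Partner

end Summit.BirchSwinnertonDyer.Rank1Residual.O6
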